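import Mathlib
import Summits.Ventures.PercRepro2.Defs
import Summits.Ventures.PercRepro2.Independence
import Summits.Ventures.PercRepro2.Graph
import Summits.Ventures.PercRepro2.Induced
import Summits.Ventures.PercRepro2.HullDefs
import Summits.Ventures.PercRepro2.HullFlip

/-!
# The all-edges piece flip is a total map `M → P` for an arbitrary core
(blind cell PercRepro2, mine-2 g9; `proofs/MINE2-PIECEFLIP.md` §1)

For a colouring `ζ` with `o` on the BLUE side of `l`, let `P := piece ζ l o` be the component of
`o` in the graph induced on `hull ∖ core` (edges of both colours) and `ζ′ := flip P ζ` the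
recolouring of every edge touching `P`. Without any non-criticality hypothesis:

* `C_R^{ζ′}(l) = C_R(l) ∪ P` (`cluster_flip_bside_eq`);
* `C_B^{ζ′}(l) ⊆ C_B(l) ∖ P` (`cluster_blue_flip_bside_subset`) — the core may shrink;
* a blue connection `h ↔_B b` from a vertex `h` outside the hull survives the flip, and indeed
  survives EVERY recolouring supported on the edges touching `P` (`conn_of_eqOn_off_touches`,
  `conn_blue_flip_of_conn_blue`): a blue path from `h` never meets `C_B(l) ⊇ P`.

Hence (`pieceFlip_total`) `ζ′` has `h ∉ H_l`, `o ∈ R_side` and `h ↔_B b`: the piece flip maps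
`M = {h ∉ H_l, o ∈ B_side, h ↔_B b}` into `P = {h ∉ H_l, o ∈ R_side, h ↔_B b}` on every graph,
with `hull ζ′ ⊆ hull ζ` and `core ζ′ ⊆ core ζ` (`hull_flip_bside_subset`, `core_flip_bside_subset`).
The red-piece statement `cluster_flip_subset` is the half of `HullFlip.cluster_flip_eq` that needs
no `NonCritRed`.
-/

namespace Summit.Ventures.PercRepro2

namespace Hull

variable {V : Type*} {E : Type*} {ends : E → Sym2 V} {ζ : Config E} {l o : V} {P : Set V}

/-- The red cluster of `l` after the flip of a red piece lies in `C_R(l) ∖ P` — the half of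
`cluster_flip_eq` that needs no non-criticality. -/
theorem cluster_flip_subset (hP : IsRedPiece ends ζ l P) :
    cluster ends (flip ends P ζ) l ⊆ cluster ends ζ l \ P := by
  intro u hu
  refine mem_of_conn_of_closed (ends := ends) (ω := flip ends P ζ)
    (S := cluster ends ζ l \ P) ?_ ⟨mem_cluster_self _ _ _, hP.l_notMem⟩ hu
  intro x hx y hxy
  obtain ⟨_, e, he, hends⟩ := exists_edge_of_adj hxy
  by_cases hyP : y ∈ P
  · exfalso
    have ht : e ∈ touches ends P := (mem_touches_iff_of_ends hends).2 (Or.inr hyP)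
    rw [flip_apply_of_mem ht] at he
    have he' : ζ e = false := by simpa using he
    by_cases hxB : x ∈ cluster ends (blue ζ) l
    · exact hP.notMem_CB hyP (mem_cluster_of_edge hxB (blue_eq_true_iff.2 he') hends)
    · exact hx.2 (hP.mem_of_edge hyP hx.1 hxB (ends_swap hends))
  · have ht : e ∉ touches ends P := fun h => by
      rcases (mem_touches_iff_of_ends hends).1 h with h | h
      · exact hx.2 h
      · exact hyP h
    rw [flip_apply_of_notMem ht] at he
    exact ⟨mem_cluster_of_edge hx.1 he hends, hyP⟩

/-- A connection from a vertex `h` outside `C_ω(l)` survives in every colouring agreeing with `ω`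
off the edges touching a subset `P ⊆ C_ω(l)`: an open path from `h` never meets `C_ω(l) ⊇ P`. -/
theorem conn_of_eqOn_off_touches {ω ω' : Config E} {h b : V} (hP : P ⊆ cluster ends ω l)
    (hh : h ∉ cluster ends ω l) (hω' : ∀ e ∉ touches ends P, ω' e = ω e)
    (hc : Conn ends ω h b) : Conn ends ω' h b := by
  have key : b ∈ {u | u ∉ cluster ends ω l ∧ Conn ends ω' h u} := by
    refine mem_of_conn_of_closed (ends := ends) (ω := ω) ?_ ⟨hh, conn_refl _ _ _⟩ hc
    intro x hx y hxy
    obtain ⟨_, e, he, hends⟩ := exists_edge_of_adj hxy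
    have hyL : y ∉ cluster ends ω l := fun hy =>
      hx.1 (mem_cluster_of_edge hy he (ends_swap hends))
    have ht : e ∉ touches ends P := fun h => by
      rcases (mem_touches_iff_of_ends hends).1 h with h | h
      · exact hx.1 (hP h)
      · exact hyL (hP h)
    have he' : ω' e = true := by rw [hω' e ht]; exact he
    exact ⟨hyL, conn_trans hx.2 (conn_of_openAdj ⟨e, he', hends⟩)⟩
  exact key.2

/-- The piece of a blue-side vertex is a red piece of the colour-swapped configuration. -/
lemma isRedPiece_blue_piece (ho : o ∈ bside ends ζ l) :
    IsRedPiece ends (blue ζ) l (piece ends ζ l o) := by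
  have ho' : o ∈ rside ends (blue ζ) l := by rw [rside_blue]; exact ho
  have hP := isRedPiece_piece ho'
  rw [piece_blue] at hP
  exact hP

/-- The piece of a blue-side vertex lies in the blue cluster of `l`. -/
lemma piece_subset_cluster_blue (ho : o ∈ bside ends ζ l) :
    piece ends ζ l o ⊆ cluster ends (blue ζ) l :=
  (isRedPiece_blue_piece ho).subset_CR

/-- **`C_R^{ζ′}(l) = C_R(l) ∪ P`** after flipping the piece `P` of a blue-side vertex `o`. -/
theorem cluster_flip_bside_eq (ho : o ∈ bside ends ζ l) :
    cluster ends (flip ends (piece ends ζ l o) ζ) l = cluster ends ζ l ∪ piece ends ζ l o := by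
  have ho' : o ∈ rside ends (blue ζ) l := by rw [rside_blue]; exact ho
  have h := cluster_blue_flip_eq (isRedPiece_piece ho')
  rw [blue_flip, blue_blue, piece_blue] at h
  exact h

/-- **`C_B^{ζ′}(l) ⊆ C_B(l) ∖ P`** after flipping the piece `P` of a blue-side vertex `o`. -/
theorem cluster_blue_flip_bside_subset (ho : o ∈ bside ends ζ l) :
    cluster ends (blue (flip ends (piece ends ζ l o) ζ)) l ⊆
      cluster ends (blue ζ) l \ piece ends ζ l o := by
  rw [blue_flip]
  exact cluster_flip_subset (isRedPiece_blue_piece ho)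

/-- A blue connection from `h ∉ H_l` survives every recolouring supported on the edges touching
the piece of a blue-side vertex `o` — the reason a `P_o`-local injection grows `C_B(h)`. -/
theorem conn_blue_of_eqOn_off_piece (ho : o ∈ bside ends ζ l) {ω : Config E} {h b : V}
    (hh : h ∉ hull ends ζ l) (hω : ∀ e ∉ touches ends (piece ends ζ l o), ω e = blue ζ e)
    (hc : Conn ends (blue ζ) h b) : Conn ends ω h b :=
  conn_of_eqOn_off_touches (piece_subset_cluster_blue ho) (fun hB => hh (Or.inr hB)) hω hc

/-- A blue connection from `h ∉ H_l` survives the flip of the piece of a blue-side vertex. -/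
theorem conn_blue_flip_of_conn_blue (ho : o ∈ bside ends ζ l) {h b : V} (hh : h ∉ hull ends ζ l)
    (hc : Conn ends (blue ζ) h b) :
    Conn ends (blue (flip ends (piece ends ζ l o) ζ)) h b := by
  rw [blue_flip]
  exact conn_blue_of_eqOn_off_piece ho hh (fun e he => flip_apply_of_notMem he) hc

/-- **The piece flip is a total map `M → P`** (arbitrary core): for `h ∉ H_l`, `o ∈ B_side` and
`h ↔_B b`, the flip `ζ′` of the piece of `o` has `h ∉ H_l^{ζ′}`, `o ∈ R_side^{ζ′}` and `h ↔_B b`. -/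
theorem pieceFlip_total (ho : o ∈ bside ends ζ l) {h b : V} (hh : h ∉ hull ends ζ l)
    (hb : Conn ends (blue ζ) h b) :
    h ∉ hull ends (flip ends (piece ends ζ l o) ζ) l ∧
      o ∈ rside ends (flip ends (piece ends ζ l o) ζ) l ∧
      Conn ends (blue (flip ends (piece ends ζ l o) ζ)) h b := by
  have hoP : o ∈ piece ends ζ l o := mem_piece_self ζ l o
  have hPB := piece_subset_cluster_blue ho
  have hR := cluster_flip_bside_eq ho
  have hB := cluster_blue_flip_bside_subset ho
  refine ⟨?_, ⟨?_, ?_⟩, conn_blue_flip_of_conn_blue ho hh hb⟩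
  · rintro (hR' | hB')
    · rw [hR] at hR'
      rcases hR' with h1 | h1
      · exact hh (Or.inl h1)
      · exact hh (Or.inr (hPB h1))
    · exact hh (Or.inr (hB hB').1)
  · rw [hR]; exact Or.inr hoP
  · intro hoB; exact (hB hoB).2 hoP

/-- The piece flip of a blue-side vertex does not enlarge the hull. -/
theorem hull_flip_bside_subset (ho : o ∈ bside ends ζ l) :
    hull ends (flip ends (piece ends ζ l o) ζ) l ⊆ hull ends ζ l := by
  rintro x (hx | hx)
  · rw [cluster_flip_bside_eq ho] at hx
    rcases hx with hx | hx
    · exact Or.inl hx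
    · exact Or.inr (piece_subset_cluster_blue ho hx)
  · exact Or.inr (cluster_blue_flip_bside_subset ho hx).1

/-- The piece flip of a blue-side vertex does not enlarge the core. -/
theorem core_flip_bside_subset (ho : o ∈ bside ends ζ l) :
    core ends (flip ends (piece ends ζ l o) ζ) l ⊆ core ends ζ l := by
  rintro x ⟨hxR, hxB⟩
  have hB := cluster_blue_flip_bside_subset ho hxB
  refine ⟨?_, hB.1⟩
  rw [cluster_flip_bside_eq ho] at hxR
  rcases hxR with hx | hx
  · exact hx
  · exact absurd hx hB.2

end Hull

end Summit.Ventures.PercRepro2
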